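import Mathlib
import HarnessLib
import Summits.NavierStokesRegularity.NavierStokesRegularity.Theorems.UnthreadedRigidityDoorUnthreadedRigidityVirialHornAngularLemma
import Summits.NavierStokesRegularity.NavierStokesRegularity.Theorems.UnthreadedRigidityDoorUnthreadedRigidityThreadingJetsVirialFields
import Summits.NavierStokesRegularity.NavierStokesRegularity.Theorems.UnthreadedRigidityDoorUnthreadedRigidityVirialHornOrderTwoBracket
import Summits.NavierStokesRegularity.NavierStokesRegularity.Theorems.UnthreadedRigidityDoorUnthreadedRigidityVirialHornZonal
import Summits.NavierStokesRegularity.NavierStokesRegularity.Theorems.UnthreadedRigidityDoorUnthreadedRigidityPersistenceSphereTools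
import Summits.NavierStokesRegularity.NavierStokesRegularity.Theorems.UnthreadedRigidityDoorUnthreadedRigidityPersistenceMeridianODE
import Summits.NavierStokesRegularity.NavierStokesRegularity.Theorems.UnthreadedRigidityDoorUnthreadedRigidityPersistenceGradSqAffineMeridian

/-!
# Route `UnthreadedRigidityDoor`, wall item W2 `UnthreadedRigidity` (stmt-NavierStokesRegularity-27585) — LINE g12-2 «PERSISTENCE FILTER»
# (ns-idea-6 g12, `Persistence_sketch.lean` 09bc8f71301208c4): the ALGEBRAIC CORE of the support S–M «SPHERE LAW» —
# `Y²` is never `p|∇Y|² + qY + c₀` on the unit sphere for a nonzero solid harmonic `Y` of degree `l ≥ 1`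

Seat ns-es-p1 g9.  Classically this is «the degree-`2l` spherical-harmonic component of `Y²` is nonzero» (equivalently `r² ∤ Y²`, or: a
harmonic polynomial vanishing on the complex null cone vanishes).  Here it is routed through CARTAN instead of spherical harmonics:

* §1 `angForm_eq_zero_of_sphere_relation` — if `Y(u)² = p|∇Y(u)|² + qY(u) + c₀` on `S²` then `{Y,|∇Y|²} ≡ 0`: the polynomial
  `D = p|∇Y|² − Y² + qY + c₀` vanishes on `S²`, so its tangential derivatives vanish there (`fderiv_eq_zero_of_vanish_on_sphere`):
  `p ∂_v|∇Y|² = (2Y − q) ∂_v Y` for `v ⊥ u`; for `p ≠ 0` this puts `∇|∇Y|²(u)` in `span(∇Y(u), u)`, for `p = 0` it makes `∇Y(u)` radial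
  (along a great circle `(2φ − q)φ′ = 0` forces `φ′ = 0`); either way `det[u, ∇Y, ∇|∇Y|²] = 0` on `S²`, and homogeneity
  (`ThreadingJets.angForm_smul`) spreads it to `ℝ³`;
* §2 hence `Y` is ZONAL (tree S-C `angularLemma_holds`), and along the meridian through a point where `Y ≠ 0` the profile
  `f(θ) = Y(cos θ·a + sin θ·b)` satisfies `f² = p(f′² + l²f²) + qf + c₀` (tree `meridian_normSq`) and the Legendre relation (tree
  `meridian_legendre`) — incompatible by `meridian_ode_contradiction`;
* ★ `no_sphere_relation` — the core: such `p, q, c₀` do not exist.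

HONEST LABEL: algebra/calculus helper for a support of a files-only RUNG line about SPECIAL single-shell data; nothing here bears on
`UnthreadedRigidity` (27585), W2 or NS regularity.  0 kit.  [folklore; Cartan 1938 via the tree's S-C]
-/

noncomputable section

-- the summit and its single sub-problem share the name (CONVENTIONS §1), as in every Theorems file
set_option linter.dupNamespace false

namespace Summit.NavierStokesRegularity.NavierStokesRegularity.Theorems.UnthreadedRigidity.Persistence

open Set Function Filter Topology
open scoped RealInnerProductSpace
open Literature.Analysis.FluidPDE (cross)
open Summit.NavierStokesRegularity.NavierStokesRegularity.Theorems.UnthreadedRigidity.ProfileHorn (E3)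
open Summit.NavierStokesRegularity.NavierStokesRegularity.Theorems.UnthreadedRigidity.VirialHorn
open Summit.NavierStokesRegularity.NavierStokesRegularity.Theorems.UnthreadedRigidity.ThreadingJets (angForm_smul)

variable {l : ℕ} {Y : E3 → ℝ}

/-! ## §1 From the sphere relation to `{Y,|∇Y|²} ≡ 0` -/

/-- `det[y, c y, w] = 0`. [folklore] -/
theorem det3_smul_self_left_mid (y w : E3) (c : ℝ) : det3 y (c • y) w = 0 := by
  simp only [det3, PiLp.smul_apply, smul_eq_mul]
  ring

/-- A vector orthogonal to every vector orthogonal to a unit vector `u` is a multiple of `u`. [folklore] -/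
theorem eq_smul_of_orthogonal_to_tangent {u W : E3} (hu : ‖u‖ = 1) (hW : ∀ v : E3, ⟪u, v⟫ = 0 → ⟪W, v⟫ = 0) :
    W = ⟪W, u⟫ • u := by
  have huu : ⟪u, u⟫ = 1 := by rw [real_inner_self_eq_norm_sq, hu, one_pow]
  set v : E3 := W - ⟪W, u⟫ • u with hv
  have huv : ⟪u, v⟫ = 0 := by
    rw [hv, inner_sub_right, real_inner_smul_right, huu, real_inner_comm u W]; ring
  have h1 : ⟪W, v⟫ = 0 := hW v huv
  have h2 : ⟪v, v⟫ = 0 := by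
    have : ⟪v, v⟫ = ⟪W, v⟫ - ⟪W, u⟫ * ⟪u, v⟫ := by
      rw [hv, inner_sub_left, real_inner_smul_left]
    rw [this, h1, huv, mul_zero, sub_zero]
  have h3 : v = 0 := inner_self_eq_zero.1 h2
  rw [hv] at h3
  exact (sub_eq_zero.1 h3)

/-- THE TANGENTIAL RELATION: if `Y² = p|∇Y|² + qY + c₀` on `S²`, then `p ∂_v|∇Y|²(u) = (2Y(u) − q) ∂_v Y(u)` for `u ∈ S²`, `v ⊥ u`
(the polynomial `p|∇Y|² − Y² + qY + c₀` vanishes on `S²`, so its tangential derivatives vanish). [folklore] -/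
theorem tangential_relation (hY : IsSolidHarmonic l Y) {p q c₀ : ℝ}
    (hrel : ∀ u : E3, ‖u‖ = 1 → Y u ^ 2 = p * ‖gradient Y u‖ ^ 2 + q * Y u + c₀)
    {u v : E3} (hu : ‖u‖ = 1) (huv : ⟪u, v⟫ = 0) :
    p * fderiv ℝ (fun z : E3 => ‖gradient Y z‖ ^ 2) u v = (2 * Y u - q) * fderiv ℝ Y u v := by
  have hYd : Differentiable ℝ Y := hY.contDiff.differentiable (by simp)
  have hGn : Differentiable ℝ (fun z : E3 => ‖gradient Y z‖ ^ 2) :=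
    (hY.contDiff_gradient.differentiable (by simp)).norm_sq ℝ
  set D : E3 → ℝ := fun z => p * ‖gradient Y z‖ ^ 2 - Y z * Y z + q * Y z + c₀ with hD
  have hD0 : ∀ z : E3, ‖z‖ = 1 → D z = 0 := fun z hz => by
    have h := hrel z hz
    rw [sq] at h
    rw [hD]
    simp only
    linarith
  have h1 : HasFDerivAt (fun z : E3 => ‖gradient Y z‖ ^ 2) (fderiv ℝ (fun z : E3 => ‖gradient Y z‖ ^ 2) u) u :=
    (hGn u).hasFDerivAt
  have h2 : HasFDerivAt Y (fderiv ℝ Y u) u := (hYd u).hasFDerivAt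
  have h3 : HasFDerivAt (fun z : E3 => Y z * Y z) ((2 * Y u) • fderiv ℝ Y u) u :=
    (h2.mul h2).congr_fderiv (by rw [mul_comm (2 : ℝ) (Y u), mul_two, add_smul])
  have hDf : HasFDerivAt D
      (p • fderiv ℝ (fun z : E3 => ‖gradient Y z‖ ^ 2) u - (2 * Y u) • fderiv ℝ Y u + q • fderiv ℝ Y u) u :=
    (((h1.const_mul p).sub h3).add (h2.const_mul q)).add_const c₀
  have hzero : fderiv ℝ D u v = 0 :=
    fderiv_eq_zero_of_vanish_on_sphere one_pos hD0 hu hDf.differentiableAt huv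
  rw [hDf.fderiv] at hzero
  simp only [FunLike.coe_sub, FunLike.coe_add, FunLike.coe_smul, Pi.sub_apply, Pi.add_apply, Pi.smul_apply, smul_eq_mul] at hzero
  linarith

/-- `p = 0`: the gradient of `Y` is RADIAL on `S²` (along the great circle through `u` with tangent `v`, `(2φ − q)φ′ = 0`; where `φ′ ≠ 0`
the profile would be locally constant). [folklore] -/
theorem fderiv_eq_zero_of_sphere_relation_zero (hY : IsSolidHarmonic l Y) {q c₀ : ℝ}
    (hrel : ∀ u : E3, ‖u‖ = 1 → Y u ^ 2 = 0 * ‖gradient Y u‖ ^ 2 + q * Y u + c₀)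
    {u v : E3} (hu : ‖u‖ = 1) (huv : ⟪u, v⟫ = 0) : fderiv ℝ Y u v = 0 := by
  have hYd : Differentiable ℝ Y := hY.contDiff.differentiable (by simp)
  by_cases hv0 : v = 0
  · rw [hv0, map_zero]
  have hvn : ‖v‖ ≠ 0 := norm_ne_zero_iff.2 hv0
  set w : E3 := (1 / ‖v‖) • v with hw
  have hwn : ‖w‖ = 1 := by
    rw [hw, norm_smul, Real.norm_eq_abs, abs_div, abs_one, abs_of_nonneg (norm_nonneg _), one_div_mul_cancel hvn]
  have huw : ⟪u, w⟫ = 0 := by rw [hw, real_inner_smul_right, huv, mul_zero]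
  -- the great circle and the profile `φ = Y ∘ γ`
  set γ : ℝ → E3 := fun s => Real.cos s • u + Real.sin s • w with hγ
  set γ' : ℝ → E3 := fun s => -Real.sin s • u + Real.cos s • w with hγ'
  set φ : ℝ → ℝ := fun s => Y (γ s) with hφ
  set φd : ℝ → ℝ := fun s => fderiv ℝ Y (γ s) (γ' s) with hφd
  have hγd : ∀ s, HasDerivAt γ (γ' s) s := fun s => hasDerivAt_gamma u w s
  have hφder : ∀ s, HasDerivAt φ (φd s) s := fun s => (hYd (γ s)).hasFDerivAt.comp_hasDerivAt s (hγd s)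
  -- `(2φ − q) φ′ = 0` along the circle
  have hrelc : ∀ s, (2 * φ s - q) * φd s = 0 := by
    intro s
    have h := tangential_relation hY hrel (norm_greatCircle hu hwn huw s) (inner_greatCircle_velocity hu hwn huw s)
    rw [zero_mul] at h
    rw [hφ, hφd]
    exact h.symm
  -- `φ′(0) = 0`
  have hφd0 : φd 0 = 0 := by
    by_contra hne
    have hφdc : ContinuousAt φd 0 := by
      have hc : Continuous φd := by
        have h1 : Continuous fun s => fderiv ℝ Y (γ s) :=
          (hY.contDiff.continuous_fderiv (by simp)).comp (continuous_iff_continuousAt.2 fun s => (hγd s).continuousAt)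
        have h2 : Continuous γ' := continuous_iff_continuousAt.2 fun s =>
          (((Real.hasDerivAt_sin s).neg.smul_const u).add ((Real.hasDerivAt_cos s).smul_const w)).continuousAt
        exact h1.clm_apply h2
      exact hc.continuousAt
    have hev : ∀ᶠ s in 𝓝 (0 : ℝ), φd s ≠ 0 := hφdc.eventually_ne hne
    have hloc : ∀ᶠ s in 𝓝 (0 : ℝ), φ s = q / 2 := hev.mono fun s hs => by
      have h := hrelc s
      have h' : 2 * φ s - q = 0 := (mul_eq_zero.1 h).resolve_right hs
      linarith
    have h0 : φd 0 = 0 := (hφder 0).unique ((hasDerivAt_const (0 : ℝ) (q / 2)).congr_of_eventuallyEq hloc)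
    exact hne h0
  -- read off `fderiv Y u v`
  have hγ0 : γ 0 = u := by rw [hγ]; simp
  have hγ'0 : γ' 0 = w := by rw [hγ']; simp
  have h1 : fderiv ℝ Y u w = 0 := by
    have : φd 0 = fderiv ℝ Y (γ 0) (γ' 0) := rfl
    rw [hγ0, hγ'0] at this
    rw [← this, hφd0]
  have hvw : v = ‖v‖ • w := by rw [hw, smul_smul, mul_one_div_cancel hvn, one_smul]
  rw [hvw, map_smul, h1, smul_zero]

/-- ★ THE ANGULAR FORM VANISHES ON `S²` under the sphere relation. [folklore] -/
theorem angForm_eq_zero_on_sphere_of_relation (hY : IsSolidHarmonic l Y) {p q c₀ : ℝ}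
    (hrel : ∀ u : E3, ‖u‖ = 1 → Y u ^ 2 = p * ‖gradient Y u‖ ^ 2 + q * Y u + c₀)
    {u : E3} (hu : ‖u‖ = 1) : angForm Y u = 0 := by
  -- `angForm Y u = det[u, ∇Y(u), ∇N(u)]`
  show det3 u (gradient Y u) (gradient (fun z : E3 => ‖gradient Y z‖ ^ 2) u) = 0
  by_cases hp : p = 0
  · -- `∇Y(u)` is radial
    subst hp
    have hrad : ∀ v : E3, ⟪u, v⟫ = 0 → ⟪gradient Y u, v⟫ = 0 := fun v huv => by
      rw [gradient, InnerProductSpace.toDual_symm_apply]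
      exact fderiv_eq_zero_of_sphere_relation_zero hY hrel hu huv
    rw [eq_smul_of_orthogonal_to_tangent hu hrad]
    exact det3_smul_self_left_mid _ _ _
  · -- `∇N(u) − ((2Y − q)/p) ∇Y(u)` is radial
    set μ : ℝ := (2 * Y u - q) / p with hμ
    set W : E3 := gradient (fun z : E3 => ‖gradient Y z‖ ^ 2) u - μ • gradient Y u with hW
    have hWt : ∀ v : E3, ⟪u, v⟫ = 0 → ⟪W, v⟫ = 0 := by
      intro v huv
      have h := tangential_relation hY hrel hu huv
      have e1 : ⟪gradient (fun z : E3 => ‖gradient Y z‖ ^ 2) u, v⟫ = fderiv ℝ (fun z : E3 => ‖gradient Y z‖ ^ 2) u v := by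
        rw [gradient, InnerProductSpace.toDual_symm_apply]
      have e2 : ⟪gradient Y u, v⟫ = fderiv ℝ Y u v := by
        rw [gradient, InnerProductSpace.toDual_symm_apply]
      have e3 : fderiv ℝ (fun z : E3 => ‖gradient Y z‖ ^ 2) u v = (2 * Y u - q) / p * fderiv ℝ Y u v := by
        rw [div_mul_eq_mul_div, eq_div_iff hp]
        linear_combination h
      rw [hW, inner_sub_left, real_inner_smul_left, e1, e2, hμ, e3]
      ring
    have hdec : gradient (fun z : E3 => ‖gradient Y z‖ ^ 2) u = μ • gradient Y u + ⟪W, u⟫ • u := by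
      have h := eq_smul_of_orthogonal_to_tangent hu hWt
      calc gradient (fun z : E3 => ‖gradient Y z‖ ^ 2) u = W + μ • gradient Y u := by rw [hW]; exact (sub_add_cancel _ _).symm
        _ = ⟪W, u⟫ • u + μ • gradient Y u := by rw [← h]
        _ = μ • gradient Y u + ⟪W, u⟫ • u := add_comm _ _
    rw [hdec, det3_add_right, det3_smul_self_mid, det3_smul_self_right, add_zero]

/-- ★ `{Y,|∇Y|²} ≡ 0` on `ℝ³` under the sphere relation (homogeneity, `angForm_smul`). [folklore] -/
theorem angForm_eq_zero_of_sphere_relation (hY : IsSolidHarmonic l Y) {p q c₀ : ℝ}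
    (hrel : ∀ u : E3, ‖u‖ = 1 → Y u ^ 2 = p * ‖gradient Y u‖ ^ 2 + q * Y u + c₀) (y : E3) : angForm Y y = 0 := by
  rcases eq_or_ne y 0 with hy | hy
  · subst hy
    simp [angForm, pbr, det3]
  · have hn : 0 < ‖y‖ := norm_pos_iff.2 hy
    set u : E3 := (1 / ‖y‖) • y with hu
    have hun : ‖u‖ = 1 := by
      rw [hu, norm_smul, Real.norm_eq_abs, abs_div, abs_one, abs_of_nonneg (norm_nonneg _), one_div_mul_cancel hn.ne']
    have hyu : y = ‖y‖ • u := by rw [hu, smul_smul, mul_one_div_cancel hn.ne', one_smul]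
    rw [hyu, angForm_smul hY hn u, angForm_eq_zero_on_sphere_of_relation hY hrel hun, mul_zero]

/-! ## §2 ★ The core: no sphere relation `Y² = p|∇Y|² + qY + c₀` for a nonzero solid harmonic of degree `l ≥ 1` -/

/-- ★ THE ALGEBRAIC CORE OF THE SPHERE LAW: for a nonzero solid harmonic `Y` of degree `l ≥ 1` there are NO constants `p, q, c₀` with
`Y(u)² = p|∇Y(u)|² + qY(u) + c₀` for all `u ∈ S²`.  (§1: `{Y,|∇Y|²} ≡ 0`, so `Y` is zonal by S-C `angularLemma_holds`; along the meridian
through a point where `Y ≠ 0` the profile satisfies `f² = p(f′² + l²f²) + qf + c₀` (`meridian_normSq`) and the Legendre relation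
(`meridian_legendre`), which `meridian_ode_contradiction` forbids.) [folklore; Cartan 1938 via S-C] -/
theorem no_sphere_relation (hl : 1 ≤ l) (hY : IsSolidHarmonic l Y) (hne : ∃ y, Y y ≠ 0) {p q c₀ : ℝ}
    (hrel : ∀ u : E3, ‖u‖ = 1 → Y u ^ 2 = p * ‖gradient Y u‖ ^ 2 + q * Y u + c₀) : False := by
  -- zonal
  have hA : ∀ y : E3, angForm Y y = 0 := angForm_eq_zero_of_sphere_relation hY hrel
  obtain ⟨a₁, ha₁, hZ₁⟩ := angularLemma_holds l Y hY hA
  have ha₁n : ‖a₁‖ ≠ 0 := norm_ne_zero_iff.2 ha₁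
  set a : E3 := (‖a₁‖⁻¹ : ℝ) • a₁ with ha_def
  have ha : ‖a‖ = 1 := by rw [ha_def, norm_smul, norm_inv, norm_norm, inv_mul_cancel₀ ha₁n]
  have hZ : IsZonalAbout a Y := fun y => by rw [ha_def, det3_smul_left, hZ₁ y, mul_zero]
  -- a unit `b ⊥ a` with the meridian through `y₁`, `Y y₁ ≠ 0`
  obtain ⟨y₁, hy₁⟩ := hne
  have hy₁0 : y₁ ≠ 0 := by
    rintro rfl
    have h := hY.apply_smul 0 (0 : E3)
    rw [zero_smul, zero_pow (by omega), zero_mul] at h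
    exact hy₁ h
  obtain ⟨w, hw0, hwy, hwa⟩ := Polyhedral.exists_perp_perp (cross a y₁) a
  have hwn : ‖w‖ ≠ 0 := norm_ne_zero_iff.2 hw0
  set b : E3 := (‖w‖⁻¹ : ℝ) • w with hb_def
  have hb : ‖b‖ = 1 := by rw [hb_def, norm_smul, norm_inv, norm_norm, inv_mul_cancel₀ hwn]
  have hab : ⟪a, b⟫ = 0 := by rw [hb_def, real_inner_smul_right, hwa, mul_zero]
  have hcy : ⟪cross a b, y₁⟫ = 0 := by
    have h1 : ⟪cross a b, y₁⟫ = -⟪cross a y₁, b⟫ := by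
      rw [← det3_eq_inner_cross_left, ← det3_eq_inner_cross_left]; unfold det3; ring
    rw [h1, hb_def, real_inner_smul_right, hwy, mul_zero, neg_zero]
  obtain ⟨B, hB0, hB1, hB2⟩ := exists_orthonormalBasis ha hb hab
  have hy₁rep : y₁ = ⟪a, y₁⟫ • a + ⟪b, y₁⟫ • b := by
    have h := B.sum_repr' y₁
    rw [Fin.sum_univ_three, hB0, hB1, hB2, hcy, zero_smul, add_zero] at h
    exact h.symm
  set ρ : ℝ := ‖y₁‖ with hρ_def
  have hρ : 0 < ρ := norm_pos_iff.2 hy₁0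
  have hsq : (⟪a, y₁⟫ / ρ) ^ 2 + (⟪b, y₁⟫ / ρ) ^ 2 = 1 := by
    have h := parseval_frame ha hb hab y₁
    rw [hcy] at h
    field_simp
    nlinarith [h]
  obtain ⟨θ₁, hcos, hsin⟩ := Literature.Analysis.FluidPDE.exists_cos_eq_sin_eq hsq
  have hγθ₁ : Real.cos θ₁ • a + Real.sin θ₁ • b = (ρ⁻¹ : ℝ) • y₁ := by
    have h := congrArg (fun v : E3 => (ρ⁻¹ : ℝ) • v) hy₁rep
    simp only [smul_add, smul_smul] at h
    rw [h, hcos, hsin, div_eq_inv_mul, div_eq_inv_mul]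
  have hf₁ : Y (Real.cos θ₁ • a + Real.sin θ₁ • b) ≠ 0 := by
    rw [hγθ₁, hY.apply_smul]
    exact mul_ne_zero (pow_ne_zero _ (inv_ne_zero hρ.ne')) hy₁
  -- the meridian functions `f`, `f′`, `f″`
  set f : ℝ → ℝ := fun t => Y (Real.cos t • a + Real.sin t • b) with hf
  set fd : ℝ → ℝ := fun t =>
    ⟪gradient Y (Real.cos t • a + Real.sin t • b), -Real.sin t • a + Real.cos t • b⟫ with hfd
  set fdd : ℝ → ℝ := fun t =>
    ⟪fderiv ℝ (gradient Y) (Real.cos t • a + Real.sin t • b) (-Real.sin t • a + Real.cos t • b),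
        -Real.sin t • a + Real.cos t • b⟫
      - ⟪gradient Y (Real.cos t • a + Real.sin t • b), Real.cos t • a + Real.sin t • b⟫ with hfdd
  have hfder : ∀ t, HasDerivAt f (fd t) t := fun t => hasDerivAt_meridian hY a b t
  have hfdder : ∀ t, HasDerivAt fd (fdd t) t := fun t => hasDerivAt_meridian_deriv hY a b t
  have hleg : ∀ t, Real.sin t * fdd t + Real.cos t * fd t + (l : ℝ) * ((l : ℝ) + 1) * Real.sin t * f t = 0 :=
    fun t => meridian_legendre hY hZ ha hb hab t
  have hE1 : ∀ t, f t ^ 2 = p * (fd t ^ 2 + (l : ℝ) ^ 2 * f t ^ 2) + q * f t + c₀ := by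
    intro t
    have h := hrel _ (norm_gamma ha hb hab t)
    rw [meridian_normSq hY hZ ha hb hab t] at h
    exact h
  exact meridian_ode_contradiction hl hfder hfdder hE1 hleg hf₁

end Summit.NavierStokesRegularity.NavierStokesRegularity.Theorems.UnthreadedRigidity.Persistence

end
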